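import Summits.Schanuel.Schanuel.Theorems.RootDecomp1KGeneric15

/-!
# RootDecomp1K — «GENERIC CELLS», part 16: FINITE EXPONENTIAL ORDER — THE CELLS: `ordTriple`, `ordCell_any`; level 2 of A₄ʰ decided, level 2 of A₄ᵈ at order ≥ 49, the dark pairs, residual shrinks

Provenance: ROOT DECOMPOSITION CELL decomp-schanuel (D-0178), lens 6 «barrier-complement carving»,
gen 13, Stage E «FINITE ORDER»; source `ORD.lean` (lens publication dir `decomp-schanuel-lens-6/g13/addendum/`).
Supports `stmt-Schanuel-33363` (A₄ʰ) AND carves item `stmt-Schanuel-33364` (A₄ᵈ `FiniteOrderLiouvilleSchanuel`):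
the pieces KS and CF of parts 05–11 only ever use ONE good rational approximation of the ratio `ρ`, so they
hold for reals of a FIXED exponential Liouville order — hyper-Liouville or not — and NW96 Thm 1 closes the
cell as soon as that order exceeds the exponent of its pair measure.  Sorry-free; standard axioms; nothing
here proves Schanuel (rung 0).

Contents: §6 `ordTriple`, `sb_generic_of_mem_ord`, `sb_generic_of_mem4_ord`, `ordCell_any` (for EVERY `u ≠ 0`, every
real `ρ` of exponential order 49 and every `w`: `SB 2 (u, ρu) ∧ SB 3 (u, ρu, w)`, mod NW96 Thm 1 ALONE),
`hyperCell_any_of_NW'`; §7 what this carves out of item 33364: `sb_two_of_ordRatio`, `ordPair_scope`,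
`finiteOrderLiouvilleSchanuel_live_at_ordPair`, `finiteOrderLiouvilleSchanuel_live_at_ordLineCell`,
`darkLiouvillePair_of_ordRatio`, `darkLiouvillePairSchanuel_ord` (the round-3 leaf `DarkLiouvillePairSchanuel`
at ratios of exponential order ≥ 49, without `ExpCurveMahler`); §8 `hyperLiouvilleSchanuel_two_of_NW` (ITEM 33363
AT n = 2 IS A THEOREM mod NW96 Thm 1 alone — its literal text), `darkHyperPairSchanuel_of_NW` (the round-4 leaf
outright), and the typed residual shrinks `sb_two_of_lowOrderResidual`, `darkLiouvillePairSchanuel_of_lowOrderResidual`,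
`sb_three_lineCell_of_lowOrderResidual` (what is left at levels 2 / 3-line: Liouville ratios WITHOUT exponential order 49).
-/

noncomputable section

open Complex Polynomial

namespace Summit.Schanuel.Schanuel.Theorems.RootDecomp1KGeneric

open Summit.Schanuel.Schanuel.Theorems.RootDecomp1KHyper
open Summit.Schanuel.Schanuel.Theorems.RootDecomp1KHyper.HyperCell

/-! ## ORD 6. The finite-order cells of A₄ᵈ ∪ A₄ʰ at `n ≤ 3` (mod NW96 Thm 1 only) -/

/-- **THE FINITE-ORDER TRIPLE (kernel, mod NW96 Thm 1).**  For every `u ≠ 0` and every real `ρ > 0` of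
exponential Liouville order `49` — hyper-Liouville OR NOT — one of the triples `(e^u, ρ, e^{ρu})`,
`(u, ρ, e^u)`, `(u, ρ, e^{ρu})` is algebraically independent over `ℚ`.  (`49 = 43 + 6`: NW96's pair measure
`exp(−c (1 + L)⁶)` at size `L = q⁷` beats the quality `exp(−q^m)` once `m ≥ 43`, and the Kummer
specialisation consumes six orders; the constant is an artefact of the bookkeeping, not of the method.) -/
theorem ordTriple (hNW : Literature.NumberTheory.Transcendental.NesterenkoWaldschmidt1996_thm_1)
    {u : ℂ} (hu0 : u ≠ 0) {ρ : ℝ} (hρ : LiouvilleOrder 49 ρ) (hρ0 : 0 < ρ) :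
    AlgebraicIndependent ℚ ![cexp u, (ρ : ℂ), cexp (u * ρ)] ∨
    AlgebraicIndependent ℚ (fun o : Option (Fin 2) => o.elim u ![(ρ : ℂ), cexp u]) ∨
    AlgebraicIndependent ℚ (fun o : Option (Fin 2) => o.elim u ![(ρ : ℂ), cexp (u * ρ)]) := by
  by_cases hA3 : AlgebraicIndependent ℚ ![cexp u, (ρ : ℂ), cexp (u * ρ)]
  · exact Or.inl hA3
  by_cases hua : IsAlgebraic (Algebra.adjoin ℚ (Set.range ![cexp u, (ρ : ℂ), cexp (u * ρ)])) u
  · exact absurd (pairApproxOrd_of_dependent hu0 (m := 43) (by norm_num) (hρ.mono (by norm_num)) hρ0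
      hA3 hua) (not_pairApproxOrd_of_NW hNW hu0 le_rfl)
  have huT : Transcendental (Algebra.adjoin ℚ (Set.range ![cexp u, (ρ : ℂ), cexp (u * ρ)])) u := hua
  rcases cylinderFunnel_ord u ρ hu0 (hρ.mono (by norm_num)) hρ0 with h1 | h2
  · refine Or.inr (Or.inl ?_)
    rw [h1.option_iff_transcendental]
    refine transcendental_adjoin_mono ?_ huT
    rintro x ⟨i, rfl⟩
    fin_cases i
    · exact ⟨1, by simp⟩
    · exact ⟨0, by simp⟩
  · refine Or.inr (Or.inr ?_)
    rw [h2.option_iff_transcendental]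
    refine transcendental_adjoin_mono ?_ huT
    rintro x ⟨i, rfl⟩
    fin_cases i
    · exact ⟨1, by simp⟩
    · exact ⟨2, by simp⟩

/-- `SB N z` (`N ≤ 3`) as soon as `ℚ(z, e^z, i)` contains `u ≠ 0`, `ρ'`, `e^u`, `e^{uρ'}` for a real
`ρ' > 0` of exponential order `49` (mod NW96 Thm 1). -/
theorem sb_generic_of_mem_ord (hNW : Literature.NumberTheory.Transcendental.NesterenkoWaldschmidt1996_thm_1)
    {u : ℂ} (hu0 : u ≠ 0) {ρ' : ℝ} (hρ' : LiouvilleOrder 49 ρ') (hρ'0 : 0 < ρ')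
    {N : ℕ} (hN : N ≤ 3) {z : Fin N → ℂ} (hu : u ∈ IntermediateField.adjoin ℚ (SFset z ∪ {I}))
    (h0 : (ρ' : ℂ) ∈ IntermediateField.adjoin ℚ (SFset z ∪ {I})) (h1 : cexp u ∈ IntermediateField.adjoin ℚ (SFset z ∪ {I}))
    (h2 : cexp (u * (ρ' : ℂ)) ∈ IntermediateField.adjoin ℚ (SFset z ∪ {I})) : SB N z := by
  rcases ordTriple hNW hu0 hρ' hρ'0 with h | h | h
  · refine sb_of_algebraicIndependent h (by simpa using hN) fun j => ?_
    fin_cases j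
    · exact h1
    · exact h0
    · exact h2
  · refine sb_of_algebraicIndependent h (by simpa using hN) fun o => ?_
    rcases o with _ | j
    · exact hu
    · fin_cases j
      · exact h0
      · exact h1
  · refine sb_of_algebraicIndependent h (by simpa using hN) fun o => ?_
    rcases o with _ | j
    · exact hu
    · fin_cases j
      · exact h0
      · exact h2

/-- The same from the four generators `u, ρu, e^u, e^{ρu}`, `ρ` of exponential order `49` of either sign. -/
theorem sb_generic_of_mem4_ord (hNW : Literature.NumberTheory.Transcendental.NesterenkoWaldschmidt1996_thm_1)
    {u : ℂ} (hu0 : u ≠ 0) {ρ : ℝ} (hρ : LiouvilleOrder 49 ρ)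
    {N : ℕ} (hN : N ≤ 3) {z : Fin N → ℂ} (hzu : u ∈ IntermediateField.adjoin ℚ (SFset z ∪ {I}))
    (hzr : (ρ : ℂ) * u ∈ IntermediateField.adjoin ℚ (SFset z ∪ {I})) (he1 : cexp ((ρ : ℂ) * u) ∈ IntermediateField.adjoin ℚ (SFset z ∪ {I}))
    (he0 : cexp u ∈ IntermediateField.adjoin ℚ (SFset z ∪ {I})) : SB N z := by
  have hρ0 : ρ ≠ 0 := hρ.ne_zero (by norm_num)
  obtain ⟨ε, hε1, hpos⟩ : ∃ ε : ℝ, (ε = 1 ∨ ε = -1) ∧ 0 < ε * ρ := by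
    rcases lt_or_gt_of_ne hρ0 with h | h
    · exact ⟨-1, Or.inr rfl, by nlinarith⟩
    · exact ⟨1, Or.inl rfl, by linarith⟩
  have hρ' : LiouvilleOrder 49 (ε * ρ) := by
    rcases hε1 with rfl | rfl
    · rw [one_mul]; exact hρ
    · rw [neg_one_mul]; exact hρ.neg
  set F := IntermediateField.adjoin ℚ (SFset z ∪ {I}) with hF
  have hρmem : (ρ : ℂ) ∈ F := by
    have hdiv := div_mem hzr hzu
    rwa [mul_div_assoc, div_self hu0, mul_one] at hdiv
  have h0 : (((ε * ρ : ℝ)) : ℂ) ∈ F := by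
    rcases hε1 with rfl | rfl
    · push_cast; rw [one_mul]; exact hρmem
    · push_cast; rw [neg_one_mul]; exact neg_mem hρmem
  have h2 : cexp (u * (((ε * ρ : ℝ)) : ℂ)) ∈ F := by
    rcases hε1 with rfl | rfl
    · have e : cexp (u * (((1 * ρ : ℝ)) : ℂ)) = cexp ((ρ : ℂ) * u) := by
        congr 1; push_cast; ring
      rw [e]; exact he1
    · have e : cexp (u * (((-1 * ρ : ℝ)) : ℂ)) = (cexp ((ρ : ℂ) * u))⁻¹ := by
        rw [← Complex.exp_neg]; congr 1; push_cast; ring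
      rw [e]; exact inv_mem he1
  exact sb_generic_of_mem_ord hNW hu0 hρ' hpos hN hzu h0 he0 h2

/-- **THE FINITE-ORDER CELLS (kernel, mod NW96 Thm 1).**  For EVERY `u ≠ 0`, every real `ρ` of exponential
Liouville order `49` (hyper-Liouville or not) and every `w`: `SB 2 (u, ρu)` and `SB 3 (u, ρu, w)`. -/
theorem ordCell_any (hNW : Literature.NumberTheory.Transcendental.NesterenkoWaldschmidt1996_thm_1)
    {u : ℂ} (hu0 : u ≠ 0) {ρ : ℝ} (hρ : LiouvilleOrder 49 ρ) (w : ℂ) :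
    SB 2 ![u, (ρ : ℂ) * u] ∧ SB 3 ![u, (ρ : ℂ) * u, w] := by
  refine ⟨?_, ?_⟩
  · exact sb_generic_of_mem4_ord hNW hu0 hρ (show 2 ≤ 3 by norm_num)
      (mem_adjoin_SFset_I' (Or.inl ⟨0, rfl⟩)) (mem_adjoin_SFset_I' (Or.inl ⟨1, rfl⟩))
      (mem_adjoin_SFset_I' (Or.inr ⟨1, rfl⟩)) (mem_adjoin_SFset_I' (Or.inr ⟨0, rfl⟩))
  · exact sb_generic_of_mem4_ord hNW hu0 hρ le_rfl
      (mem_adjoin_SFset_I' (Or.inl ⟨0, rfl⟩)) (mem_adjoin_SFset_I' (Or.inl ⟨1, rfl⟩))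
      (mem_adjoin_SFset_I' (Or.inr ⟨1, rfl⟩)) (mem_adjoin_SFset_I' (Or.inr ⟨0, rfl⟩))

/-- The generic hyper-Liouville cells of part 02 (`hyperCell_any`), re-derived modulo NW96 Thm 1 ALONE through
the finite-order machinery (every hyper-Liouville real has every exponential order). -/
theorem hyperCell_any_of_NW' (hNW : Literature.NumberTheory.Transcendental.NesterenkoWaldschmidt1996_thm_1)
    {u : ℂ} (hu0 : u ≠ 0) {ρ : ℝ} (hρ : HyperLiouville ρ) (w : ℂ) :
    SB 2 ![u, (ρ : ℂ) * u] ∧ SB 3 ![u, (ρ : ℂ) * u, w] :=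
  ordCell_any hNW hu0 (LiouvilleOrder.of_hyperLiouville hρ 49) w

/-! ## ORD 7. What this carves out of A₄ᵈ = `FiniteOrderLiouvilleSchanuel` (item 33364)

At level `n = 2` every point of A₃ ⊇ A₄ᵈ is a pair `(t, ρt)` with `ρ` a real Liouville number
(`exists_liouville_ratio_of_linLiouville`), and it lies in A₄ᵈ (not in A₄ʰ) iff `ρ` is NOT hyper-Liouville
(`hyperLinLiouville_pair_iff`).  The theorem below decides ALL such pairs whose ratio has exponential order
`≥ 49` — the first cells of item 33364 decided with `e^{ρt}` load-bearing; what is left of level 2 of A₄ᵈ is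
the band of Liouville ratios of exponential order `< 49` (in truth: below the exponent of the best pair
measure), where the critic's `(ℓ_b, ℓ_b²)`, `ℓ_b = Σ b^{−k!}` (exponential order `0`), sits. -/

/-- **Level 2 of A₄ᵈ ∪ A₄ʰ at exponential order ≥ 49 (kernel, mod NW96 Thm 1).**  Every ℚ-free pair with a
real ratio of exponential Liouville order `49` has Schanuel's bound. -/
theorem sb_two_of_ordRatio (hNW : Literature.NumberTheory.Transcendental.NesterenkoWaldschmidt1996_thm_1)
    {z : Fin 2 → ℂ} (hz : LinearIndependent ℚ z) {ρ : ℝ} (hρ : LiouvilleOrder 49 ρ)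
    (h1 : z 1 = (ρ : ℂ) * z 0) : SB 2 z := by
  have ez : z = ![z 0, (ρ : ℂ) * z 0] := by
    funext i; fin_cases i
    · rfl
    · simpa using h1
  rw [ez]
  exact (ordCell_any hNW (hz.ne_zero 0) hρ 0).1

/-- Such pairs ARE in the scope of A₃ (`LinLiouville`), and in the scope of A₄ᵈ proper (NOT `HyperLinLiouville`)
exactly when the ratio is not hyper-Liouville (tree: `linLiouville_of_liouville_ratio`,
`not_hyperLinLiouville_of_ratio_not_hyperLiouville`). -/
theorem ordPair_scope {t : ℂ} {ρ : ℝ} (hρ : LiouvilleOrder 49 ρ) :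
    LinLiouville ![t, (ρ : ℂ) * t] ∧
      (¬ HyperLiouville ρ → LinearIndependent ℚ ![t, (ρ : ℂ) * t] → ¬ HyperLinLiouville ![t, (ρ : ℂ) * t]) :=
  ⟨linLiouville_of_liouville_ratio (hρ.liouville (by norm_num)) t,
    fun hx hz => not_hyperLinLiouville_of_ratio_not_hyperLiouville hx hz⟩

/-- **Live text of item 33364 (`FiniteOrderLiouvilleSchanuel`) at `n = 2`, at every pair with a ratio of
exponential order ≥ 49** (mod NW96 Thm 1) — both Liouville hypotheses idle. -/
theorem finiteOrderLiouvilleSchanuel_live_at_ordPair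
    (hNW : Literature.NumberTheory.Transcendental.NesterenkoWaldschmidt1996_thm_1) {t : ℂ} {ρ : ℝ}
    (hρ : LiouvilleOrder 49 ρ) :
    LinearIndependent ℚ ![t, (ρ : ℂ) * t] →
    (∀ ω : ℕ, ∃ h : Fin 2 → ℤ, h ≠ 0 ∧
      ‖∑ i, (h i : ℂ) * ![t, (ρ : ℂ) * t] i‖ < 1 / (1 + ∑ i, (|h i| : ℝ)) ^ ω) →
    (¬ ∀ m : ℕ, ∃ h : Fin 2 → ℤ, h ≠ 0 ∧
      ‖∑ i, (h i : ℂ) * ![t, (ρ : ℂ) * t] i‖ < Real.exp (-((1 + ∑ i, (|h i| : ℝ)) ^ m))) →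
    ((2 : ℕ) : Cardinal) ≤ Algebra.trdeg ℚ ↥(IntermediateField.adjoin ℚ
      (Set.range ![t, (ρ : ℂ) * t] ∪ Set.range (Complex.exp ∘ ![t, (ρ : ℂ) * t]))) :=
  fun hz _ _ => (ordCell_any hNW (hz.ne_zero 0) hρ ((ρ : ℂ) * t)).1

/-- **Live text of item 33364 at `n = 3`, at every line cell `(u, ρu, w)` with `ρ` of exponential order
≥ 49 and ANY third coordinate `w`** (mod NW96 Thm 1). -/
theorem finiteOrderLiouvilleSchanuel_live_at_ordLineCell
    (hNW : Literature.NumberTheory.Transcendental.NesterenkoWaldschmidt1996_thm_1) {u : ℂ} (hu0 : u ≠ 0)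
    {ρ : ℝ} (hρ : LiouvilleOrder 49 ρ) (w : ℂ) :
    LinearIndependent ℚ ![u, (ρ : ℂ) * u, w] →
    (∀ ω : ℕ, ∃ h : Fin 3 → ℤ, h ≠ 0 ∧
      ‖∑ i, (h i : ℂ) * ![u, (ρ : ℂ) * u, w] i‖ < 1 / (1 + ∑ i, (|h i| : ℝ)) ^ ω) →
    (¬ ∀ m : ℕ, ∃ h : Fin 3 → ℤ, h ≠ 0 ∧
      ‖∑ i, (h i : ℂ) * ![u, (ρ : ℂ) * u, w] i‖ < Real.exp (-((1 + ∑ i, (|h i| : ℝ)) ^ m))) →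
    ((3 : ℕ) : Cardinal) ≤ Algebra.trdeg ℚ ↥(IntermediateField.adjoin ℚ
      (Set.range ![u, (ρ : ℂ) * u, w] ∪ Set.range (Complex.exp ∘ ![u, (ρ : ℂ) * u, w]))) :=
  fun _ _ _ => (ordCell_any hNW hu0 hρ w).2

/-- **The DARK Liouville pairs of exponential order ≥ 49 (kernel, mod NW96 Thm 1).**  The body of
`DarkLiouvillePairSchanuel` — level 2 of A₃ EXACTLY (§13b of the round-3 node: `t`, `e^t` transcendental and
algebraically dependent, `ρ` Liouville) — at every ratio of exponential order `49`, with the darkness hypotheses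
idle and WITHOUT the open leaf `ExpCurveMahler`.  What is left of level 2 of A₄ᵈ: dark pairs whose Liouville
ratio has exponential order below the exponent of the pair measure. -/
theorem darkLiouvillePair_of_ordRatio
    (hNW : Literature.NumberTheory.Transcendental.NesterenkoWaldschmidt1996_thm_1) {t : ℂ} (ht : t ≠ 0)
    {ρ : ℝ} (hρ : LiouvilleOrder 49 ρ) :
    (2 : Cardinal) ≤ Algebra.trdeg ℚ ↥(IntermediateField.adjoin ℚ
      (Set.range ![t, (ρ : ℂ) * t] ∪ Set.range (cexp ∘ ![t, (ρ : ℂ) * t]))) := by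
  have h : ((2 : ℕ) : Cardinal) ≤ Algebra.trdeg ℚ ↥(IntermediateField.adjoin ℚ
      (Set.range ![t, (ρ : ℂ) * t] ∪ Set.range (cexp ∘ ![t, (ρ : ℂ) * t]))) :=
    (ordCell_any hNW ht hρ ((ρ : ℂ) * t)).1
  exact_mod_cast h

/-- Hence `DarkLiouvillePairSchanuel` restricted to ratios of exponential order ≥ 49 (mod NW96 Thm 1). -/
theorem darkLiouvillePairSchanuel_ord
    (hNW : Literature.NumberTheory.Transcendental.NesterenkoWaldschmidt1996_thm_1) :
    ∀ (t : ℂ) (ρ : ℝ), LiouvilleOrder 49 ρ → Transcendental ℚ t → Transcendental ℚ (cexp t) →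
      ¬ AlgebraicIndependent ℚ ![t, cexp t] →
      (2 : Cardinal) ≤ Algebra.trdeg ℚ ↥(IntermediateField.adjoin ℚ
        (Set.range ![t, (ρ : ℂ) * t] ∪ Set.range (cexp ∘ ![t, (ρ : ℂ) * t]))) :=
  fun _ _ hρ ht _ _ => darkLiouvillePair_of_ordRatio hNW (transcendental_ne_zero ht) hρ

/-! ## ORD 8. Level 2: item 33363 at `n = 2` is a theorem mod NW96 Thm 1; level 2 of A₃ shrinks to the low-order dark pairs -/

/-- **ITEM 33363 (`HyperLiouvilleSchanuel`, A₄ʰ) AT `n = 2` IS A THEOREM mod NW96 Thm 1 ALONE** — its literal text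
restricted to pairs: a ℚ-free hyper-lin-Liouville pair is `(t, ρt)` with `ρ` hyper-Liouville
(`exists_hyperLiouville_ratio_of_hyperLinLiouville`), i.e. a generic cell of exponential order `49`.  (Round 4 had
reduced this level to the leaf `DarkHyperPairSchanuel` modulo the measures `hW`, `hlm`, `hX`; none of them is needed.) -/
theorem hyperLiouvilleSchanuel_two_of_NW
    (hNW : Literature.NumberTheory.Transcendental.NesterenkoWaldschmidt1996_thm_1) :
    ∀ z : Fin 2 → ℂ, LinearIndependent ℚ z →
      (∀ m : ℕ, ∃ h : Fin 2 → ℤ, h ≠ 0 ∧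
        ‖∑ i, (h i : ℂ) * z i‖ < Real.exp (-((1 + ∑ i, (|h i| : ℝ)) ^ m))) →
      ((2 : ℕ) : Cardinal) ≤ Algebra.trdeg ℚ ↥(IntermediateField.adjoin ℚ
        (Set.range z ∪ Set.range (Complex.exp ∘ z))) := by
  intro z hz hH
  obtain ⟨ρ, hρ, h1⟩ := exists_hyperLiouville_ratio_of_hyperLinLiouville hz hH
  exact sb_two_of_ordRatio hNW hz (LiouvilleOrder.of_hyperLiouville hρ 49) h1

/-- The round-4 leaf `DarkHyperPairSchanuel` outright (mod NW96 Thm 1), all four side hypotheses idle. -/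
theorem darkHyperPairSchanuel_of_NW
    (hNW : Literature.NumberTheory.Transcendental.NesterenkoWaldschmidt1996_thm_1) : DarkHyperPairSchanuel :=
  fun _ _ hρ ht _ _ _ =>
    darkLiouvillePair_of_ordRatio hNW (transcendental_ne_zero ht) (LiouvilleOrder.of_hyperLiouville hρ 49)

/-- **RESIDUAL SHRINK at level 2 (mod NW96 Thm 1).**  Level 2 of A₃ (= of `LinLiouvilleSchanuel` = A₄ʰ ∪ A₄ᵈ at
`n = 2`) follows from Schanuel's bound at the pairs `(t, ρt)`, `t ≠ 0`, whose Liouville ratio `ρ` has NO exponential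
order `49` — the new residual of record for item 33364 at `n = 2` (it contains `(ℓ_b, ℓ_b²)`). -/
theorem sb_two_of_lowOrderResidual
    (hNW : Literature.NumberTheory.Transcendental.NesterenkoWaldschmidt1996_thm_1)
    (hres : ∀ (t : ℂ) (ρ : ℝ), t ≠ 0 → Liouville ρ → ¬ LiouvilleOrder 49 ρ → SB 2 ![t, (ρ : ℂ) * t])
    (z : Fin 2 → ℂ) (hz : LinearIndependent ℚ z) (hL : LinLiouville z) : SB 2 z := by
  obtain ⟨ρ, hρ, h1⟩ := exists_liouville_ratio_of_linLiouville hz hL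
  by_cases hord : LiouvilleOrder 49 ρ
  · exact sb_two_of_ordRatio hNW hz hord h1
  · have ez : z = ![z 0, (ρ : ℂ) * z 0] := by
      funext i; fin_cases i
      · rfl
      · simpa using h1
    rw [ez]
    exact hres (z 0) ρ (hz.ne_zero 0) hρ hord

/-- The same shrink for the round-3 leaf: `DarkLiouvillePairSchanuel` follows from its restriction to ratios without
exponential order `49` (mod NW96 Thm 1). -/
theorem darkLiouvillePairSchanuel_of_lowOrderResidual
    (hNW : Literature.NumberTheory.Transcendental.NesterenkoWaldschmidt1996_thm_1)
    (hres : ∀ (t : ℂ) (ρ : ℝ), Liouville ρ → ¬ LiouvilleOrder 49 ρ → Transcendental ℚ t →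
      Transcendental ℚ (cexp t) → ¬ AlgebraicIndependent ℚ ![t, cexp t] →
      (2 : Cardinal) ≤ Algebra.trdeg ℚ ↥(IntermediateField.adjoin ℚ
        (Set.range ![t, (ρ : ℂ) * t] ∪ Set.range (cexp ∘ ![t, (ρ : ℂ) * t])))) :
    DarkLiouvillePairSchanuel := by
  intro t ρ hρ ht het hdep
  by_cases hord : LiouvilleOrder 49 ρ
  · exact darkLiouvillePair_of_ordRatio hNW (transcendental_ne_zero ht) hord
  · exact hres t ρ hρ hord ht het hdep

/-- **RESIDUAL SHRINK at the level-3 line cells (mod NW96 Thm 1)**: Schanuel's bound at every line cell `(u, ρu, w)`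
with a real Liouville ratio follows from the cells whose ratio has NO exponential order `49`. -/
theorem sb_three_lineCell_of_lowOrderResidual
    (hNW : Literature.NumberTheory.Transcendental.NesterenkoWaldschmidt1996_thm_1)
    (hres : ∀ (u : ℂ) (ρ : ℝ) (w : ℂ), u ≠ 0 → Liouville ρ → ¬ LiouvilleOrder 49 ρ → SB 3 ![u, (ρ : ℂ) * u, w])
    {u : ℂ} (hu0 : u ≠ 0) {ρ : ℝ} (hρ : Liouville ρ) (w : ℂ) : SB 3 ![u, (ρ : ℂ) * u, w] := by
  by_cases hord : LiouvilleOrder 49 ρ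
  · exact (ordCell_any hNW hu0 hord w).2
  · exact hres u ρ w hu0 hρ hord

end Summit.Schanuel.Schanuel.Theorems.RootDecomp1KGeneric
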